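import Summits.NavierStokesRegularity.NavierStokesRegularity.Theorems.StretchingWellBindingEnstrophyQuarterLawSparsenessCore
import Summits.NavierStokesRegularity.NavierStokesRegularity.Theorems.StretchingWellBindingEnstrophyQuarterLawSparseSieveCharacterisation
import Summits.NavierStokesRegularity.NavierStokesRegularity.Theorems.StretchingWellBindingEnstrophyQuarterLawSparseSieveAssembly
import Summits.NavierStokesRegularity.NavierStokesRegularity.Theses.HalfHolderEnergy
import HarnessLib

/-!
# Crux `HalfHolderEnergy.EnergyHalfHolder` (stmt-NavierStokesRegularity-25161), line «sparse_sieve» (line3):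
# the registered skeleton IN THE TREE'S VOCABULARY — composition and exact status of the open stubs

Helper file (`--supports stmt-NavierStokesRegularity-25161 --as helper`), the sibling of
`…EnstrophyQuarterLawRegisteredStatus` (p817733) for the window-law crux. The skeleton registered on 25161 has the
five typed pieces of `…EnstrophyQuarterLawSparseSieveDefs` (p817378) with the SAME registered signatures as on 1574;
its stubs 3/4/5 are retired by name (p818822/p818823/p818824). In the registered vocabulary:

* `energyHalfHolder_of_stubs` — THE SKELETON THEOREM of line3, Theorems-side: S1 (`UniformLocalTypeI`) and S2
  (`UniformSparseness`) at every first blow-up imply `EnergyHalfHolder` BY NAME (content: p615745);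
* `energyHalfHolder_iff_stubs` — `EnergyHalfHolder ⟺ (∀ S1) ∧ (∀ S2)` (p816651, folded): the line's cut is EXACT;
* `energyHalfHolder_iff_stub_uniformLocalTypeI_and_core` — with ONE absolute `c₀`:
  `EnergyHalfHolder ⟺ (∀ S1) ∧ (∀ first blow-ups, CORE)` where CORE is the near-field / fine-scale / late-time /
  above-the-enstrophy-scale part of S2 (`SparsenessCore.uniformSparseness_iff_core`, p818258).

HONEST FRAMING: implications/equivalences between OPEN statements; `EnergyHalfHolder` (25161), S1, S2 and the shelf
crux `EnstrophyQuarterLaw` (1574) stay OPEN; nothing here bears on Navier–Stokes regularity; no summit statement is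
proved.
-/

noncomputable section

-- the summit and its single sub-problem share the name (CONVENTIONS §1), as in every Theorems file
set_option linter.dupNamespace false

namespace Summit.NavierStokesRegularity.NavierStokesRegularity.Theorems.EnergyHalfHolder.SparseSieve.Registered

open MeasureTheory Set Metric
open Literature.Analysis.FluidPDE
open Summit.NavierStokesRegularity.NavierStokesRegularity.Theorems.EnstrophyQuarterLaw
open Summit.NavierStokesRegularity.NavierStokesRegularity.Theorems.EnstrophyQuarterLaw.SparseSieve
open scoped ENNReal

/-- **The skeleton theorem of line3 «sparse_sieve» on `EnergyHalfHolder`, Theorems-side:** the two OPEN registered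
stubs S1 `stub_uniformLocalTypeI` and S2 `stub_uniformSparseness` (signatures verbatim) imply the crux
`EnergyHalfHolder` BY NAME (stubs 3/4/5 are tree theorems; content
`SparseSieve.energyHalfHolder_of_uniformLocalTypeI_of_uniformSparseness`, p615745). Conditional on OPEN statements;
no summit statement is proved. [folklore] -/
theorem energyHalfHolder_of_stubs
    (hS1 : ∀ (ν T : ℝ), 0 < ν → 0 < T →
      ∀ (u : ℝ → EuclideanSpace ℝ (Fin 3) → EuclideanSpace ℝ (Fin 3))
        (p : ℝ → EuclideanSpace ℝ (Fin 3) → ℝ),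
      IsMaximalSmoothSolution ν 0 u p T → IsLerayHopfOn T ν 0 (u 0) u →
      HasRapidSpatialDecay (u 0) → UniformLocalTypeI T u)
    (hS2 : ∀ (ν T : ℝ), 0 < ν → 0 < T →
      ∀ (u : ℝ → EuclideanSpace ℝ (Fin 3) → EuclideanSpace ℝ (Fin 3))
        (p : ℝ → EuclideanSpace ℝ (Fin 3) → ℝ),
      IsMaximalSmoothSolution ν 0 u p T → IsLerayHopfOn T ν 0 (u 0) u →
      HasRapidSpatialDecay (u 0) → UniformSparseness T u) :
    Summit.NavierStokesRegularity.NavierStokesRegularity.Theses.HalfHolderEnergy.EnergyHalfHolder :=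
  SparseSieve.energyHalfHolder_of_uniformLocalTypeI_of_uniformSparseness hS1 hS2

/-- **`EnergyHalfHolder ⟺ (∀ S1) ∧ (∀ S2)`** in the registered vocabulary (p816651 folded): the window quarter law
at every first blow-up iff every first blow-up is uniformly locally Type I and uniformly sparse. Equivalence of
OPEN statements. [folklore] -/
theorem energyHalfHolder_iff_stubs :
    Summit.NavierStokesRegularity.NavierStokesRegularity.Theses.HalfHolderEnergy.EnergyHalfHolder ↔
    ((∀ (ν T : ℝ), 0 < ν → 0 < T →
      ∀ (u : ℝ → EuclideanSpace ℝ (Fin 3) → EuclideanSpace ℝ (Fin 3))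
        (p : ℝ → EuclideanSpace ℝ (Fin 3) → ℝ),
      IsMaximalSmoothSolution ν 0 u p T → IsLerayHopfOn T ν 0 (u 0) u →
      HasRapidSpatialDecay (u 0) → UniformLocalTypeI T u) ∧
     (∀ (ν T : ℝ), 0 < ν → 0 < T →
      ∀ (u : ℝ → EuclideanSpace ℝ (Fin 3) → EuclideanSpace ℝ (Fin 3))
        (p : ℝ → EuclideanSpace ℝ (Fin 3) → ℝ),
      IsMaximalSmoothSolution ν 0 u p T → IsLerayHopfOn T ν 0 (u 0) u →
      HasRapidSpatialDecay (u 0) → UniformSparseness T u)) :=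
  SparseSieveCharacterisation.energyHalfHolder_iff_uniformLocalTypeI_and_uniformSparseness

/-- **`EnergyHalfHolder ⟺ (∀ S1) ∧ (∀ first blow-ups, CORE of S2)`** with one absolute `c₀`: beyond uniform local
Type I, the window law asks only for bounded NEAR-FIELD, FINE-SCALE, LATE swarms ABOVE THE ENSTROPHY SCALE
(`SparsenessCore.uniformSparseness_iff_core`). Equivalence of OPEN statements. [folklore] -/
theorem energyHalfHolder_iff_stub_uniformLocalTypeI_and_core :
    ∃ c₀ : ℝ, 0 < c₀ ∧
      (Summit.NavierStokesRegularity.NavierStokesRegularity.Theses.HalfHolderEnergy.EnergyHalfHolder ↔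
        ((∀ (ν T : ℝ), 0 < ν → 0 < T →
          ∀ (u : ℝ → EuclideanSpace ℝ (Fin 3) → EuclideanSpace ℝ (Fin 3))
            (p : ℝ → EuclideanSpace ℝ (Fin 3) → ℝ),
          IsMaximalSmoothSolution ν 0 u p T → IsLerayHopfOn T ν 0 (u 0) u →
          HasRapidSpatialDecay (u 0) → UniformLocalTypeI T u) ∧
         ∀ (ν T : ℝ), 0 < ν → 0 < T →
          ∀ (u : ℝ → EuclideanSpace ℝ (Fin 3) → EuclideanSpace ℝ (Fin 3))
            (p : ℝ → EuclideanSpace ℝ (Fin 3) → ℝ),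
          IsMaximalSmoothSolution ν 0 u p T → IsLerayHopfOn T ν 0 (u 0) u →
          HasRapidSpatialDecay (u 0) →
          ∀ ρ : ℝ, 0 < ρ → ∃ r₁ : ℝ, 0 < r₁ ∧ ∀ ε₀ : ℝ, 0 < ε₀ → ∃ N₁ : ℕ,
            ∀ t ∈ Set.Ico (T / 2) T, ∀ r ∈ Set.Ioc 0 r₁,
              c₀ * ε₀ ^ 2 < r * (∫⁻ y, ‖curl (u t) y‖ₑ ^ 2).toReal →
              ∀ F : Finset (EuclideanSpace ℝ (Fin 3)),
                (∀ x ∈ F, ∀ y ∈ F, x ≠ y → 4 * r ≤ dist x y) →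
                (∀ x ∈ F, ENNReal.ofReal (ε₀ ^ 3) ≤ ∫⁻ y in Metric.ball x (2 * r), ‖u t y‖ₑ ^ 3) →
                (∀ x ∈ F, ‖x‖ < ρ) → F.card ≤ N₁)) := by
  obtain ⟨c₀, hc₀, hcore⟩ := SparsenessCore.uniformSparseness_iff_core
  refine ⟨c₀, hc₀, ?_⟩
  rw [energyHalfHolder_iff_stubs]
  refine ⟨fun h => ⟨h.1, fun ν T hν hT u p hmax hLH hdec => ?_⟩,
    fun h => ⟨h.1, fun ν T hν hT u p hmax hLH hdec => ?_⟩⟩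
  · exact (hcore ν T hν hT u p hmax hLH hdec).1 (h.2 ν T hν hT u p hmax hLH hdec)
  · exact (hcore ν T hν hT u p hmax hLH hdec).2 (h.2 ν T hν hT u p hmax hLH hdec)

end Summit.NavierStokesRegularity.NavierStokesRegularity.Theorems.EnergyHalfHolder.SparseSieve.Registered

end
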